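import Literature.NumberTheory.EllipticCurves.Fisher2012.HesseFamilyThreeCongruenceProofs
import Literature.NumberTheory.EllipticCurves.QuadraticTwist
import HarnessLib

/-!
# Route `SignedLowerHalves`, crux `KobayashiMainConjectureSmallImage` (item stmt-BirchSwinnertonDyer-19002) —
# «L4-DIHEDRAL» kernel records @ 3: the CM SHADOW of each newform-partnered non-surjective `a_3 = 0` pair, certified as a
# SELF-TWIST `3`-CONGRUENCE `E[3] ≅ E^{(d_K)}[3]` in Fisher's Hesse pencil (cell `bsd-ssimc`, seat `bsd-ssimc-k3-c4` gen 10;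
# `--supports stmt-BirchSwinnertonDyer-19002 --as helper`)

HONEST FRAMING: Kobayashi's signed main conjecture at a non-surjective (normaliser-of-non-split-Cartan) image is OPEN as a
class statement; item 4 stays OPEN; nothing here is booked; BSD is not proved by any of this. These are PER-PAIR STRUCTURE
certificates (not main-conjecture records): they type, in the kernel, the one datum every CM-shadow road of the item consumes.

WHAT IS CERTIFIED. For each of the eleven item-4 window pairs `(E, 3)` that have NO CM elliptic-curve partner over `ℚ`
(memo k3c4-MEMO-8-addE §5: `K` of class number `> 1` — `ℚ(√−91)`, `ℚ(√−148)`, `ℚ(√−139)`, `ℚ(√−52)`, `ℚ(√−31)`), a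
`Γ_ℚ`-equivariant isomorphism `E^{(d_K)}[3] ≃ E[3]`, where `E^{(d_K)} = W.quadraticTwist d_K` is the tree's model of the
quadratic twist by the discriminant `d_K` of the dihedral field `K` (`Literature/…/QuadraticTwist.lean`: `c₄(W^d) = d²c₄`,
`c₆(W^d) = d³c₆`). Since `E^{(d)}[3] ≅ E[3] ⊗ ε_d` (`ε_d` the quadratic character of `ℚ(√d)`), the certificate says
`ρ̄_{E,3} ≅ ρ̄_{E,3} ⊗ ε_K`; for an irreducible `ρ̄` (the tree's `ClassX7.irr` / `irr3_s…`) this is EQUIVALENT to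
`ρ̄_{E,3} ≅ Ind_K^ℚ χ̄` for a character `χ̄` of `Γ_K` — the «CM shadow» (image = normaliser of a Cartan with ITS field `K`),
which the seat's census (gen 0, `cm_congruence_probe.tsv`) had only as an `a_ℓ`-statistic (`a_ℓ ≡ 0 (mod 3)` at `K`-inert `ℓ ≤ 400`).
The equivalence «self-twist ⟺ induced» and its use (a weight-2 CM NEWFORM `θ(ψ)` of `K` congruent to `f_E` — the partner of
the cell's newform road «L4-JLK», memo k3c4-MEMO-9) are NOT asserted here; only the isomorphism of `3`-torsion modules is.

MECHANISM: Fisher, Proc. LMS 104 (2012) Thm. 13.2, `n = 3` — in the tree as the UNCONDITIONAL kernel theorem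
`threeCongruent_of_hesseCertificate_unconditional` (Hesse pencil `X_E(3)`, DIRECT family; the twist sits in the direct =
symplectic family, as it must for the normaliser of a NON-split Cartan at `p ≡ 3 (mod 4)`: the `𝔽_3`-rational intertwiner
`ρ̄ ⊗ ε_K → ρ̄` has square determinant). Per pair the certificate is a rational point `(λ : μ)` of `X_E(3)` and a scaling
`u ∈ ℚ^×` with `𝔠₄(λ,μ) = u⁴·d²c₄(E)`, `𝔠₆(λ,μ) = u⁶·d³c₆(E)` — two identities of rational numbers, closed by `norm_num`
(closed forms `eval_hesseC4three` / `eval_hesseC6three`). Certificates found by exact projective search over `ℙ¹(ℚ)` (factor the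
`j`-equation on the affine chart + the point `(1:0)`; kit job j272679, `--workitem stmt-BirchSwinnertonDyer-19002`; the DUAL
family `X_E^-(3)` has NO rational point with `j = j(E)` for any of the eleven, as the same job records). The by-product point
`(1:0)` of `X_E(3)` is `E` itself (twist class `d_K` relative to `E^{(d_K)}`), a sanity check of the normalisation.

Dihedral fields (kit j272679, `a_ℓ(E) ≡ 0 (mod 3)` at EVERY good `K`-inert `ℓ ≤ 4000`, 261–284 primes per pair, 0 violations;
no other imaginary quadratic field of `|d| ≤ 400` with `3` inert passes): `414050ca1`, `314678r1/bz1/ca1/cc1` ↦ `ℚ(√−91)`;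
`219040i1`, `481888n1` ↦ `ℚ(√−37)` (`d_K = −148`); `270494e1` ↦ `ℚ(√−139)`; `378560fp1` ↦ `ℚ(√−13)` (`d_K = −52`);
`430528v1/y1` ↦ `ℚ(√−31)`. In every case the twist `E^{(d_K)}` has the SAME conductor as `E` (kit j272679).

PARTITION (cell bsd-ssimc): X7 (A7) × item 4's eleven newform-partnered pairs @ 3 — types-the-object-of (the CM shadow);
closes NONE; 0 census moves.

References: [Fisher2012Hessian] Thm. 13.2 (n = 3), §8; [SilvermanAEC2009] X.5 Cor. 5.4, III §1; [Cremona2006] Table 1.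
Memo: `HOME/k3c4-MEMO-9.md` (cell bsd-ssimc).
-/

set_option autoImplicit false
set_option linter.dupNamespace false

noncomputable section

open scoped Classical

open WeierstrassCurve Literature.NumberTheory.EllipticCurves Literature.NumberTheory.EllipticCurves.Fisher2012

namespace Summit.BirchSwinnertonDyer.BirchSwinnertonDyer.Theorems

/-! ### §1 The self-twist form of the Hesse certificate -/

/-- **Self-twist `3`-congruence from a direct Hesse certificate.** For an elliptic curve `W/ℚ`, `d ≠ 0` and `l m u : ℚ`,
`u ≠ 0`, with `𝔠₄(l,m) = u⁴·(d²·c₄(W))` and `𝔠₆(l,m) = u⁶·(d³·c₆(W))` (Fisher's `n = 3` Hesse covariants of `W`), the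
quadratic twist `W^d = W.quadraticTwist d` (tree model, `c₄(W^d) = d²c₄`, `c₆(W^d) = d³c₆`) satisfies `W^d[3] ≅ W[3]` as
`Γ_ℚ`-modules — `threeCongruent_of_hesseCertificate_unconditional` with `G := W.quadraticTwist d` (elliptic by
`isElliptic_quadraticTwist`). [cite: Fisher2012Hessian, Thm. 13.2 (n = 3)] [cite: SilvermanAEC2009, X.5 Cor. 5.4] -/
theorem threeCongruent_quadraticTwist_of_hesseCertificate (W : WeierstrassCurve ℚ) [W.IsElliptic] (d l m u : ℚ)
    (hd : d ≠ 0) (hu : u ≠ 0)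
    (h4 : MvPolynomial.eval ![l, m] (hesseC4three W.c₄ W.c₆) = u ^ 4 * (d ^ 2 * W.c₄))
    (h6 : MvPolynomial.eval ![l, m] (hesseC6three W.c₄ W.c₆) = u ^ 6 * (d ^ 3 * W.c₆)) :
    ∃ e : geomTorsion (W.quadraticTwist d) (3 : ℤ) ≃+ geomTorsion W (3 : ℤ),
      ∀ (σ : Field.absoluteGaloisGroup ℚ) (Q : geomTorsion (W.quadraticTwist d) (3 : ℤ)), e (σ • Q) = σ • e Q := by
  haveI : (W.quadraticTwist d).IsElliptic := isElliptic_quadraticTwist W hd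
  refine threeCongruent_of_hesseCertificate_unconditional W (W.quadraticTwist d) l m u hu ?_ ?_
  · rw [quadraticTwist_c₄]; exact h4
  · rw [quadraticTwist_c₆]; exact h6

/-! ### §2 The records: `E[3] ≅ E^{(d_K)}[3]` for the eleven newform-partnered item-4 pairs @ 3 -/

/-- **`414050ca1[3] ≅ 414050ca1^{(-91)}[3]` (Γ_ℚ-equivariantly): the CM shadow of `414050ca1 @ 3` is `K = ℚ(√−91)` (`d_K = -91`, `h_K = 2`,
`3` inert).** Cremona model `[1, -1, 0, -2007560242, 34736666216916]` (`N = 414050 = 2 · 5^2 · 7^2 · 13^2`, `r_an = 0`; X7, `a_3 = 0`, image `3Nn`); the twist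
`W.quadraticTwist (-91)` is `ℚ`-isomorphic to the curve of conductor `414050` with minimal model `[1, -1, 1, -242430, -46034803]` (kit j272679). KERNEL
certificate: `E^{(-91)}` ≅ the member `(786695/3 : 1)` of Fisher's Hesse pencil `X_E(3)` (direct family), `u = 29120/3`
(`threeCongruent_quadraticTwist_of_hesseCertificate`, `norm_num`). Dihedral check (not used by the kernel): `a_ℓ ≡ 0 (mod 3)` at all
284 good `K`-inert `ℓ ≤ 4000`. Structure only; item 4 stays OPEN; nothing booked; BSD is not proved by any of this.
[cite: Fisher2012Hessian, Thm. 13.2 (n = 3)] [cite: Cremona2006, Table 1 (Cremona label 414050ca1)] -/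
theorem selfTwistThree_c414050ca1 (W : WeierstrassCurve ℚ) [W.IsElliptic]
    (hW : W = ⟨1, -1, 0, -2007560242, 34736666216916⟩) :
    ∃ e : geomTorsion (W.quadraticTwist (-91 : ℚ)) (3 : ℤ) ≃+ geomTorsion W (3 : ℤ),
      ∀ (σ : Field.absoluteGaloisGroup ℚ) (Q : geomTorsion (W.quadraticTwist (-91 : ℚ)) (3 : ℤ)), e (σ • Q) = σ • e Q := by
  have hc4 : W.c₄ = (96362891625 : ℚ) := by
    subst hW; norm_num [WeierstrassCurve.c₄, WeierstrassCurve.b₂, WeierstrassCurve.b₄]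
  have hc6 : W.c₆ = (-30012045978403125 : ℚ) := by
    subst hW; norm_num [WeierstrassCurve.c₆, WeierstrassCurve.b₂, WeierstrassCurve.b₄, WeierstrassCurve.b₆]
  exact threeCongruent_quadraticTwist_of_hesseCertificate W (-91 : ℚ) ((786695 : ℚ) / 3) (1 : ℚ) ((29120 : ℚ) / 3)
    (by norm_num) (by norm_num) (by rw [hc4, hc6, eval_hesseC4three]; norm_num) (by rw [hc4, hc6, eval_hesseC6three]; norm_num)

/-- **`314678ca1[3] ≅ 314678ca1^{(-91)}[3]` (Γ_ℚ-equivariantly): the CM shadow of `314678ca1 @ 3` is `K = ℚ(√−91)` (`d_K = -91`, `h_K = 2`,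
`3` inert).** Cremona model `[1, -1, 1, 56847512, -24780487637]` (`N = 314678 = 2 · 7^2 · 13^2 · 19`, `r_an = 1`; X7, `a_3 = 0`, image `3Nn`); the twist
`W.quadraticTwist (-91)` is `ℚ`-isomorphic to the curve of conductor `314678` with minimal model `[1, -1, 0, 6865, 31149]` (kit j272679). KERNEL
certificate: `E^{(-91)}` ≅ the member `(-1051687 : 1)` of Fisher's Hesse pencil `X_E(3)` (direct family), `u = 110656`
(`threeCongruent_quadraticTwist_of_hesseCertificate`, `norm_num`). Dihedral check (not used by the kernel): `a_ℓ ≡ 0 (mod 3)` at all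
284 good `K`-inert `ℓ ≤ 4000`. Structure only; item 4 stays OPEN; nothing booked; BSD is not proved by any of this.
[cite: Fisher2012Hessian, Thm. 13.2 (n = 3)] [cite: Cremona2006, Table 1 (Cremona label 314678ca1)] -/
theorem selfTwistThree_c314678ca1 (W : WeierstrassCurve ℚ) [W.IsElliptic]
    (hW : W = ⟨1, -1, 1, 56847512, -24780487637⟩) :
    ∃ e : geomTorsion (W.quadraticTwist (-91 : ℚ)) (3 : ℤ) ≃+ geomTorsion W (3 : ℤ),
      ∀ (σ : Field.absoluteGaloisGroup ℚ) (Q : geomTorsion (W.quadraticTwist (-91 : ℚ)) (3 : ℤ)), e (σ • Q) = σ • e Q := by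
  have hc4 : W.c₄ = (-2728680591 : ℚ) := by
    subst hW; norm_num [WeierstrassCurve.c₄, WeierstrassCurve.b₂, WeierstrassCurve.b₄]
  have hc6 : W.c₆ = (21398062255479 : ℚ) := by
    subst hW; norm_num [WeierstrassCurve.c₆, WeierstrassCurve.b₂, WeierstrassCurve.b₄, WeierstrassCurve.b₆]
  exact threeCongruent_quadraticTwist_of_hesseCertificate W (-91 : ℚ) (-1051687 : ℚ) (1 : ℚ) (110656 : ℚ)
    (by norm_num) (by norm_num) (by rw [hc4, hc6, eval_hesseC4three]; norm_num) (by rw [hc4, hc6, eval_hesseC6three]; norm_num)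

/-- **`219040i1[3] ≅ 219040i1^{(-148)}[3]` (Γ_ℚ-equivariantly): the CM shadow of `219040i1 @ 3` is `K = ℚ(√−37)` (`d_K = -148`, `h_K = 2`,
`3` inert).** Cremona model `[0, 0, 0, 50653, 138687914]` (`N = 219040 = 2^5 · 5 · 37^2`, `r_an = 0`; X7, `a_3 = 0`, image `3Nn`); the twist
`W.quadraticTwist (-148)` is `ℚ`-isomorphic to the curve of conductor `219040` with minimal model `[0, 0, 0, 37, -2738]` (kit j272679). KERNEL
certificate: `E^{(-148)}` ≅ the member `(5476 : 1)` of Fisher's Hesse pencil `X_E(3)` (direct family), `u = 740`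
(`threeCongruent_quadraticTwist_of_hesseCertificate`, `norm_num`). Dihedral check (not used by the kernel): `a_ℓ ≡ 0 (mod 3)` at all
261 good `K`-inert `ℓ ≤ 4000`. Structure only; item 4 stays OPEN; nothing booked; BSD is not proved by any of this.
[cite: Fisher2012Hessian, Thm. 13.2 (n = 3)] [cite: Cremona2006, Table 1 (Cremona label 219040i1)] -/
theorem selfTwistThree_c219040i1 (W : WeierstrassCurve ℚ) [W.IsElliptic]
    (hW : W = ⟨0, 0, 0, 50653, 138687914⟩) :
    ∃ e : geomTorsion (W.quadraticTwist (-148 : ℚ)) (3 : ℤ) ≃+ geomTorsion W (3 : ℤ),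
      ∀ (σ : Field.absoluteGaloisGroup ℚ) (Q : geomTorsion (W.quadraticTwist (-148 : ℚ)) (3 : ℤ)), e (σ • Q) = σ • e Q := by
  have hc4 : W.c₄ = (-2431344 : ℚ) := by
    subst hW; norm_num [WeierstrassCurve.c₄, WeierstrassCurve.b₂, WeierstrassCurve.b₄]
  have hc6 : W.c₆ = (-119826357696 : ℚ) := by
    subst hW; norm_num [WeierstrassCurve.c₆, WeierstrassCurve.b₂, WeierstrassCurve.b₄, WeierstrassCurve.b₆]
  exact threeCongruent_quadraticTwist_of_hesseCertificate W (-148 : ℚ) (5476 : ℚ) (1 : ℚ) (740 : ℚ)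
    (by norm_num) (by norm_num) (by rw [hc4, hc6, eval_hesseC4three]; norm_num) (by rw [hc4, hc6, eval_hesseC6three]; norm_num)

/-- **`270494e1[3] ≅ 270494e1^{(-139)}[3]` (Γ_ℚ-equivariantly): the CM shadow of `270494e1 @ 3` is `K = ℚ(√−139)` (`d_K = -139`, `h_K = 3`,
`3` inert).** Cremona model `[1, -1, 1, -392128, 94695459]` (`N = 270494 = 2 · 7 · 139^2`, `r_an = 0`; X7, `a_3 = 0`, image `3Nn`); the twist
`W.quadraticTwist (-139)` is `ℚ`-isomorphic to the curve of conductor `270494` with minimal model `[1, -1, 0, -7576299050, -254050754150732]` (kit j272679). KERNEL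
certificate: `E^{(-139)}` ≅ the member `(290371/75 : 1)` of Fisher's Hesse pencil `X_E(3)` (direct family), `u = 5488/75`
(`threeCongruent_quadraticTwist_of_hesseCertificate`, `norm_num`). Dihedral check (not used by the kernel): `a_ℓ ≡ 0 (mod 3)` at all
274 good `K`-inert `ℓ ≤ 4000`. Structure only; item 4 stays OPEN; nothing booked; BSD is not proved by any of this.
[cite: Fisher2012Hessian, Thm. 13.2 (n = 3)] [cite: Cremona2006, Table 1 (Cremona label 270494e1)] -/
theorem selfTwistThree_c270494e1 (W : WeierstrassCurve ℚ) [W.IsElliptic]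
    (hW : W = ⟨1, -1, 1, -392128, 94695459⟩) :
    ∃ e : geomTorsion (W.quadraticTwist (-139 : ℚ)) (3 : ℤ) ≃+ geomTorsion W (3 : ℤ),
      ∀ (σ : Field.absoluteGaloisGroup ℚ) (Q : geomTorsion (W.quadraticTwist (-139 : ℚ)) (3 : ℤ)), e (σ • Q) = σ • e Q := by
  have hc4 : W.c₄ = (18822129 : ℚ) := by
    subst hW; norm_num [WeierstrassCurve.c₄, WeierstrassCurve.b₂, WeierstrassCurve.b₄]
  have hc6 : W.c₆ = (-81732177225 : ℚ) := by
    subst hW; norm_num [WeierstrassCurve.c₆, WeierstrassCurve.b₂, WeierstrassCurve.b₄, WeierstrassCurve.b₆]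
  exact threeCongruent_quadraticTwist_of_hesseCertificate W (-139 : ℚ) ((290371 : ℚ) / 75) (1 : ℚ) ((5488 : ℚ) / 75)
    (by norm_num) (by norm_num) (by rw [hc4, hc6, eval_hesseC4three]; norm_num) (by rw [hc4, hc6, eval_hesseC6three]; norm_num)

/-- **`314678bz1[3] ≅ 314678bz1^{(-91)}[3]` (Γ_ℚ-equivariantly): the CM shadow of `314678bz1 @ 3` is `K = ℚ(√−91)` (`d_K = -91`, `h_K = 2`,
`3` inert).** Cremona model `[1, -1, 1, -2238606, -1287188899]` (`N = 314678 = 2 · 7^2 · 13^2 · 19`, `r_an = 0`; X7, `a_3 = 0`, image `3Nn`); the twist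
`W.quadraticTwist (-91)` is `ℚ`-isomorphic to the curve of conductor `314678` with minimal model `[1, -1, 0, -649063, 201208125]` (kit j272679). KERNEL
certificate: `E^{(-91)}` ≅ the member `(-178633/15 : 1)` of Fisher's Hesse pencil `X_E(3)` (direct family), `u = 3952/15`
(`threeCongruent_quadraticTwist_of_hesseCertificate`, `norm_num`). Dihedral check (not used by the kernel): `a_ℓ ≡ 0 (mod 3)` at all
284 good `K`-inert `ℓ ≤ 4000`. Structure only; item 4 stays OPEN; nothing booked; BSD is not proved by any of this.
[cite: Fisher2012Hessian, Thm. 13.2 (n = 3)] [cite: Cremona2006, Table 1 (Cremona label 314678bz1)] -/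
theorem selfTwistThree_c314678bz1 (W : WeierstrassCurve ℚ) [W.IsElliptic]
    (hW : W = ⟨1, -1, 1, -2238606, -1287188899⟩) :
    ∃ e : geomTorsion (W.quadraticTwist (-91 : ℚ)) (3 : ℤ) ≃+ geomTorsion W (3 : ℤ),
      ∀ (σ : Field.absoluteGaloisGroup ℚ) (Q : geomTorsion (W.quadraticTwist (-91 : ℚ)) (3 : ℤ)), e (σ • Q) = σ • e Q := by
  have hc4 : W.c₄ = (107453073 : ℚ) := by
    subst hW; norm_num [WeierstrassCurve.c₄, WeierstrassCurve.b₂, WeierstrassCurve.b₄]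
  have hc6 : W.c₆ = (1112614747335 : ℚ) := by
    subst hW; norm_num [WeierstrassCurve.c₆, WeierstrassCurve.b₂, WeierstrassCurve.b₄, WeierstrassCurve.b₆]
  exact threeCongruent_quadraticTwist_of_hesseCertificate W (-91 : ℚ) ((-178633 : ℚ) / 15) (1 : ℚ) ((3952 : ℚ) / 15)
    (by norm_num) (by norm_num) (by rw [hc4, hc6, eval_hesseC4three]; norm_num) (by rw [hc4, hc6, eval_hesseC6three]; norm_num)

/-- **`314678cc1[3] ≅ 314678cc1^{(-91)}[3]` (Γ_ℚ-equivariantly): the CM shadow of `314678cc1 @ 3` is `K = ℚ(√−91)` (`d_K = -91`, `h_K = 2`,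
`3` inert).** Cremona model `[1, -1, 1, 1160153, 71914847]` (`N = 314678 = 2 · 7^2 · 13^2 · 19`, `r_an = 0`; X7, `a_3 = 0`, image `3Nn`); the twist
`W.quadraticTwist (-91)` is `ℚ`-isomorphic to the curve of conductor `314678` with minimal model `[1, -1, 0, 336376, -11356864]` (kit j272679). KERNEL
certificate: `E^{(-91)}` ≅ the member `(150241 : 1)` of Fisher's Hesse pencil `X_E(3)` (direct family), `u = 15808`
(`threeCongruent_quadraticTwist_of_hesseCertificate`, `norm_num`). Dihedral check (not used by the kernel): `a_ℓ ≡ 0 (mod 3)` at all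
284 good `K`-inert `ℓ ≤ 4000`. Structure only; item 4 stays OPEN; nothing booked; BSD is not proved by any of this.
[cite: Fisher2012Hessian, Thm. 13.2 (n = 3)] [cite: Cremona2006, Table 1 (Cremona label 314678cc1)] -/
theorem selfTwistThree_c314678cc1 (W : WeierstrassCurve ℚ) [W.IsElliptic]
    (hW : W = ⟨1, -1, 1, 1160153, 71914847⟩) :
    ∃ e : geomTorsion (W.quadraticTwist (-91 : ℚ)) (3 : ℤ) ≃+ geomTorsion W (3 : ℤ),
      ∀ (σ : Field.absoluteGaloisGroup ℚ) (Q : geomTorsion (W.quadraticTwist (-91 : ℚ)) (3 : ℤ)), e (σ • Q) = σ • e Q := by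
  have hc4 : W.c₄ = (-55687359 : ℚ) := by
    subst hW; norm_num [WeierstrassCurve.c₄, WeierstrassCurve.b₂, WeierstrassCurve.b₄]
  have hc6 : W.c₆ = (-62385021153 : ℚ) := by
    subst hW; norm_num [WeierstrassCurve.c₆, WeierstrassCurve.b₂, WeierstrassCurve.b₄, WeierstrassCurve.b₆]
  exact threeCongruent_quadraticTwist_of_hesseCertificate W (-91 : ℚ) (150241 : ℚ) (1 : ℚ) (15808 : ℚ)
    (by norm_num) (by norm_num) (by rw [hc4, hc6, eval_hesseC4three]; norm_num) (by rw [hc4, hc6, eval_hesseC6three]; norm_num)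

/-- **`314678r1[3] ≅ 314678r1^{(-91)}[3]` (Γ_ℚ-equivariantly): the CM shadow of `314678r1 @ 3` is `K = ℚ(√−91)` (`d_K = -91`, `h_K = 2`,
`3` inert).** Cremona model `[1, -1, 0, -13246, -582828]` (`N = 314678 = 2 · 7^2 · 13^2 · 19`, `r_an = 0`; X7, `a_3 = 0`, image `3Nn`); the twist
`W.quadraticTwist (-91)` is `ℚ`-isomorphic to the curve of conductor `314678` with minimal model `[1, -1, 1, -109691679, 441725175623]` (kit j272679). KERNEL
certificate: `E^{(-91)}` ≅ the member `(-13741/15 : 1)` of Fisher's Hesse pencil `X_E(3)` (direct family), `u = 304/15`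
(`threeCongruent_quadraticTwist_of_hesseCertificate`, `norm_num`). Dihedral check (not used by the kernel): `a_ℓ ≡ 0 (mod 3)` at all
284 good `K`-inert `ℓ ≤ 4000`. Structure only; item 4 stays OPEN; nothing booked; BSD is not proved by any of this.
[cite: Fisher2012Hessian, Thm. 13.2 (n = 3)] [cite: Cremona2006, Table 1 (Cremona label 314678r1)] -/
theorem selfTwistThree_c314678r1 (W : WeierstrassCurve ℚ) [W.IsElliptic]
    (hW : W = ⟨1, -1, 0, -13246, -582828⟩) :
    ∃ e : geomTorsion (W.quadraticTwist (-91 : ℚ)) (3 : ℤ) ≃+ geomTorsion W (3 : ℤ),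
      ∀ (σ : Field.absoluteGaloisGroup ℚ) (Q : geomTorsion (W.quadraticTwist (-91 : ℚ)) (3 : ℤ)), e (σ • Q) = σ • e Q := by
  have hc4 : W.c₄ = (635817 : ℚ) := by
    subst hW; norm_num [WeierstrassCurve.c₄, WeierstrassCurve.b₂, WeierstrassCurve.b₄]
  have hc6 : W.c₆ = (506424555 : ℚ) := by
    subst hW; norm_num [WeierstrassCurve.c₆, WeierstrassCurve.b₂, WeierstrassCurve.b₄, WeierstrassCurve.b₆]
  exact threeCongruent_quadraticTwist_of_hesseCertificate W (-91 : ℚ) ((-13741 : ℚ) / 15) (1 : ℚ) ((304 : ℚ) / 15)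
    (by norm_num) (by norm_num) (by rw [hc4, hc6, eval_hesseC4three]; norm_num) (by rw [hc4, hc6, eval_hesseC6three]; norm_num)

/-- **`378560fp1[3] ≅ 378560fp1^{(-52)}[3]` (Γ_ℚ-equivariantly): the CM shadow of `378560fp1 @ 3` is `K = ℚ(√−13)` (`d_K = -52`, `h_K = 2`,
`3` inert).** Cremona model `[0, 0, 0, -5032087892, -127118829942624]` (`N = 378560 = 2^6 · 5 · 7 · 13^2`, `r_an = 0`; X7, `a_3 = 0`, image `3Nn`); the twist
`W.quadraticTwist (-52)` is `ℚ`-isomorphic to the curve of conductor `378560` with minimal model `[0, 0, 0, -29775668, 57860186592]` (kit j272679). KERNEL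
certificate: `E^{(-52)}` ≅ the member `(-83132452/87 : 1)` of Fisher's Hesse pencil `X_E(3)` (direct family), `u = 7803250/87`
(`threeCongruent_quadraticTwist_of_hesseCertificate`, `norm_num`). Dihedral check (not used by the kernel): `a_ℓ ≡ 0 (mod 3)` at all
277 good `K`-inert `ℓ ≤ 4000`. Structure only; item 4 stays OPEN; nothing booked; BSD is not proved by any of this.
[cite: Fisher2012Hessian, Thm. 13.2 (n = 3)] [cite: Cremona2006, Table 1 (Cremona label 378560fp1)] -/
theorem selfTwistThree_c378560fp1 (W : WeierstrassCurve ℚ) [W.IsElliptic]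
    (hW : W = ⟨0, 0, 0, -5032087892, -127118829942624⟩) :
    ∃ e : geomTorsion (W.quadraticTwist (-52 : ℚ)) (3 : ℤ) ≃+ geomTorsion W (3 : ℤ),
      ∀ (σ : Field.absoluteGaloisGroup ℚ) (Q : geomTorsion (W.quadraticTwist (-52 : ℚ)) (3 : ℤ)), e (σ • Q) = σ • e Q := by
  have hc4 : W.c₄ = (241540218816 : ℚ) := by
    subst hW; norm_num [WeierstrassCurve.c₄, WeierstrassCurve.b₂, WeierstrassCurve.b₄]
  have hc6 : W.c₆ = (109830669070427136 : ℚ) := by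
    subst hW; norm_num [WeierstrassCurve.c₆, WeierstrassCurve.b₂, WeierstrassCurve.b₄, WeierstrassCurve.b₆]
  exact threeCongruent_quadraticTwist_of_hesseCertificate W (-52 : ℚ) ((-83132452 : ℚ) / 87) (1 : ℚ) ((7803250 : ℚ) / 87)
    (by norm_num) (by norm_num) (by rw [hc4, hc6, eval_hesseC4three]; norm_num) (by rw [hc4, hc6, eval_hesseC6three]; norm_num)

/-- **`430528v1[3] ≅ 430528v1^{(-31)}[3]` (Γ_ℚ-equivariantly): the CM shadow of `430528v1 @ 3` is `K = ℚ(√−31)` (`d_K = -31`, `h_K = 3`,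
`3` inert).** Cremona model `[0, 0, 0, -13516, -599664]` (`N = 430528 = 2^6 · 7 · 31^2`, `r_an = 0`; X7, `a_3 = 0`, image `3Nn`); the twist
`W.quadraticTwist (-31)` is `ℚ`-isomorphic to the curve of conductor `430528` with minimal model `[0, 0, 0, -12988876, 17864590224]` (kit j272679). KERNEL
certificate: `E^{(-31)}` ≅ the member `(-3224/3 : 1)` of Fisher's Hesse pencil `X_E(3)` (direct family), `u = 224/3`
(`threeCongruent_quadraticTwist_of_hesseCertificate`, `norm_num`). Dihedral check (not used by the kernel): `a_ℓ ≡ 0 (mod 3)` at all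
275 good `K`-inert `ℓ ≤ 4000`. Structure only; item 4 stays OPEN; nothing booked; BSD is not proved by any of this.
[cite: Fisher2012Hessian, Thm. 13.2 (n = 3)] [cite: Cremona2006, Table 1 (Cremona label 430528v1)] -/
theorem selfTwistThree_c430528v1 (W : WeierstrassCurve ℚ) [W.IsElliptic]
    (hW : W = ⟨0, 0, 0, -13516, -599664⟩) :
    ∃ e : geomTorsion (W.quadraticTwist (-31 : ℚ)) (3 : ℤ) ≃+ geomTorsion W (3 : ℤ),
      ∀ (σ : Field.absoluteGaloisGroup ℚ) (Q : geomTorsion (W.quadraticTwist (-31 : ℚ)) (3 : ℤ)), e (σ • Q) = σ • e Q := by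
  have hc4 : W.c₄ = (648768 : ℚ) := by
    subst hW; norm_num [WeierstrassCurve.c₄, WeierstrassCurve.b₂, WeierstrassCurve.b₄]
  have hc6 : W.c₆ = (518109696 : ℚ) := by
    subst hW; norm_num [WeierstrassCurve.c₆, WeierstrassCurve.b₂, WeierstrassCurve.b₄, WeierstrassCurve.b₆]
  exact threeCongruent_quadraticTwist_of_hesseCertificate W (-31 : ℚ) ((-3224 : ℚ) / 3) (1 : ℚ) ((224 : ℚ) / 3)
    (by norm_num) (by norm_num) (by rw [hc4, hc6, eval_hesseC4three]; norm_num) (by rw [hc4, hc6, eval_hesseC6three]; norm_num)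

/-- **`430528y1[3] ≅ 430528y1^{(-31)}[3]` (Γ_ℚ-equivariantly): the CM shadow of `430528y1 @ 3` is `K = ℚ(√−31)` (`d_K = -31`, `h_K = 3`,
`3` inert).** Cremona model `[0, 0, 0, -12988876, 17864590224]` (`N = 430528 = 2^6 · 7 · 31^2`, `r_an = 0`; X7, `a_3 = 0`, image `3Nn`); the twist
`W.quadraticTwist (-31)` is `ℚ`-isomorphic to the curve of conductor `430528` with minimal model `[0, 0, 0, -13516, -599664]` (kit j272679). KERNEL
certificate: `E^{(-31)}` ≅ the member `(99944/3 : 1)` of Fisher's Hesse pencil `X_E(3)` (direct family), `u = 6944/3`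
(`threeCongruent_quadraticTwist_of_hesseCertificate`, `norm_num`). Dihedral check (not used by the kernel): `a_ℓ ≡ 0 (mod 3)` at all
275 good `K`-inert `ℓ ≤ 4000`. Structure only; item 4 stays OPEN; nothing booked; BSD is not proved by any of this.
[cite: Fisher2012Hessian, Thm. 13.2 (n = 3)] [cite: Cremona2006, Table 1 (Cremona label 430528y1)] -/
theorem selfTwistThree_c430528y1 (W : WeierstrassCurve ℚ) [W.IsElliptic]
    (hW : W = ⟨0, 0, 0, -12988876, 17864590224⟩) :
    ∃ e : geomTorsion (W.quadraticTwist (-31 : ℚ)) (3 : ℤ) ≃+ geomTorsion W (3 : ℤ),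
      ∀ (σ : Field.absoluteGaloisGroup ℚ) (Q : geomTorsion (W.quadraticTwist (-31 : ℚ)) (3 : ℤ)), e (σ • Q) = σ • e Q := by
  have hc4 : W.c₄ = (623466048 : ℚ) := by
    subst hW; norm_num [WeierstrassCurve.c₄, WeierstrassCurve.b₂, WeierstrassCurve.b₄]
  have hc6 : W.c₆ = (-15435005953536 : ℚ) := by
    subst hW; norm_num [WeierstrassCurve.c₆, WeierstrassCurve.b₂, WeierstrassCurve.b₄, WeierstrassCurve.b₆]
  exact threeCongruent_quadraticTwist_of_hesseCertificate W (-31 : ℚ) ((99944 : ℚ) / 3) (1 : ℚ) ((6944 : ℚ) / 3)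
    (by norm_num) (by norm_num) (by rw [hc4, hc6, eval_hesseC4three]; norm_num) (by rw [hc4, hc6, eval_hesseC6three]; norm_num)

/-- **`481888n1[3] ≅ 481888n1^{(-148)}[3]` (Γ_ℚ-equivariantly): the CM shadow of `481888n1 @ 3` is `K = ℚ(√−37)` (`d_K = -148`, `h_K = 2`,
`3` inert).** Cremona model `[0, 0, 0, -16465, -804972]` (`N = 481888 = 2^5 · 11 · 37^2`, `r_an = 0`; X7, `a_3 = 0`, image `3Nn`); the twist
`W.quadraticTwist (-148)` is `ℚ`-isomorphic to the curve of conductor `481888` with minimal model `[0, 0, 0, -22540585, 40774246716]` (kit j272679). KERNEL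
certificate: `E^{(-148)}` ≅ the member `(-3626/3 : 1)` of Fisher's Hesse pencil `X_E(3)` (direct family), `u = 121/3`
(`threeCongruent_quadraticTwist_of_hesseCertificate`, `norm_num`). Dihedral check (not used by the kernel): `a_ℓ ≡ 0 (mod 3)` at all
261 good `K`-inert `ℓ ≤ 4000`. Structure only; item 4 stays OPEN; nothing booked; BSD is not proved by any of this.
[cite: Fisher2012Hessian, Thm. 13.2 (n = 3)] [cite: Cremona2006, Table 1 (Cremona label 481888n1)] -/
theorem selfTwistThree_c481888n1 (W : WeierstrassCurve ℚ) [W.IsElliptic]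
    (hW : W = ⟨0, 0, 0, -16465, -804972⟩) :
    ∃ e : geomTorsion (W.quadraticTwist (-148 : ℚ)) (3 : ℤ) ≃+ geomTorsion W (3 : ℤ),
      ∀ (σ : Field.absoluteGaloisGroup ℚ) (Q : geomTorsion (W.quadraticTwist (-148 : ℚ)) (3 : ℤ)), e (σ • Q) = σ • e Q := by
  have hc4 : W.c₄ = (790320 : ℚ) := by
    subst hW; norm_num [WeierstrassCurve.c₄, WeierstrassCurve.b₂, WeierstrassCurve.b₄]
  have hc6 : W.c₆ = (695495808 : ℚ) := by
    subst hW; norm_num [WeierstrassCurve.c₆, WeierstrassCurve.b₂, WeierstrassCurve.b₄, WeierstrassCurve.b₆]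
  exact threeCongruent_quadraticTwist_of_hesseCertificate W (-148 : ℚ) ((-3626 : ℚ) / 3) (1 : ℚ) ((121 : ℚ) / 3)
    (by norm_num) (by norm_num) (by rw [hc4, hc6, eval_hesseC4three]; norm_num) (by rw [hc4, hc6, eval_hesseC6three]; norm_num)

end Summit.BirchSwinnertonDyer.BirchSwinnertonDyer.Theorems

end
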